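import Summits.CriticalPhenomena.PercolationContinuityZ3.Theorems.PercNearOneGluingNoHeavyLowerTailKnQuestion8CoefficientwiseQmixHybrid
import Summits.CriticalPhenomena.PercolationContinuityZ3.Theorems.PercNearOneGluingNoHeavyLowerTailKnQuestion8CoefficientwiseQmixStarClass
import Summits.CriticalPhenomena.PercolationContinuityZ3.Theorems.PercNearOneGluingNoHeavyLowerTailKnQuestion8CoefficientwiseNoCoreCross
import Summits.CriticalPhenomena.PercolationContinuityZ3.Theorems.PercNearOneGluingNoHeavyLowerTailKnQuestion8CoefficientwiseNoCoreNbhd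
import HarnessLib

/-!
# The two-point exclusion `Q_mix(p,q)[1_u, g]` at a degree-two `u` with `N(u) = {p,q}` (the DIAMOND), and NO-CORE for the twin diamond — prim-lf-2 gen 50 (part 2 of 2)

Support file (`--supports stmt-CriticalPhenomena-4575`, closed), prover `prim-lf-2` (gen 50).  No definitions, no named facts, no sorries; standard axioms.
Memo `prim-lf-2/CW-ANATOMY-gen49.md` §3 (iii), §3.5 and HANDOFF gen 49 §NEXT (3)–(4); context `prim-lf-2/CW-HT-gen48.md` §3c (CONJECTURE Q_mix / NO-CORE).

Setting.  Finite multigraph `ends : ι → Sym2 V`, root `x`, colourings `s : Finset ι` (red) / `sᶜ` (blue), `K(s) = openCluster (ends '' s) x`, `ĝ(s) = g(K s) − g(K sᶜ)`,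
`σ_v(s) = [v ∈ K s] − [v ∈ K sᶜ]`.  The two-point exclusion with `f = 1_u` is `Q_mix(p,q)[1_u,g] = Σ_{s : ¬(p ∈ K s ∧ q ∈ K sᶜ)} σ_u ĝ` (CONJECTURE Q_mix: `≥ 0`).
Resolving the two edges `i₁ = up`, `i₂ = uq` of a vertex `u` of degree two gives four classes; three are signed by `…CoefficientwiseQmixStarClass.lean` (gen 49:
`up` red, or `up, uq` both blue).  This file closes the fourth class (`up` blue, `uq` red) when these are ALL the edges at `u`:
* `hybrid_nonneg` — the hybrid-spin exclusion `HYB(p,q)[g] = Σ_t [¬(p ∈ K t ∧ q ∈ K tᶜ)]·([q ∈ K t] − [p ∈ K tᶜ])·ĝ(t)` is `≥ 0` for monotone `g`: part 1's identity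
  `hybrid_eq_half_cross` (`2·HYB = NO-CORE(q)[1_p] + NO-CORE(p)[1_q]`) + THEOREM CROSS (`noCore_cross_nonneg`, gen 49);
* `qmix_nonneg_of_degTwo` — **THEOREM (DIAMOND): if `u ∉ {x,p,q}` has exactly the two edges `up`, `uq`, then `Q_mix(p,q)[1_u, g] ≥ 0` for every monotone `g` ignoring `u`**
  (`sum_cube_eq_sum_powerset_subcube` over `D = {i₁,i₂}` + the three gen-49 classes `qmixStarClass_nonneg_of_red`/`_blue_blue` + part 1's `degTwo_blueRed_class_eq_hybrid` + `hybrid_nonneg`);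
* `noCore_twinDiamond_nonneg` — **COROLLARY (TWIN DIAMOND): if `y` and `u` both have exactly two edges, to the same two vertices `p, q` (`x, y, u, p, q` suitably distinct),
  then `NO-CORE(y)[1_u, g] = Σ_{s : ¬(y ∈ K s ∧ y ∈ K sᶜ)} σ_u ĝ ≥ 0` for every monotone `g` ignoring `y` and `u`** — gen 48's degree-two reduction
  (`noCore_degTwo_nonneg_of_qmix`) fed with the DIAMOND on `G − y` in both orientations.  This is HANDOFF-48's 'smallest open shape' of CONJECTURE NO-CORE for the point
  functions (deg-2 `y` with `N(y) = {p,q} ⊆ N(u)`) in the case `N(u) = {p,q}`, now kernel-checked.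
Exact pre-checks (prim-lf-2 code/gen49/c/cross.c, nbr2.c): `2·HYB = CROSS` as functionals and all four `u`-star classes `≥ 0` on all graphs with ≤ 7 vertices (≤ 8 edges), exact min over
all monotone `g`.
[cite: KozmaNitzan2024, Questions 8–9 (§5.5 p. 36) (context: the Question-8 pocket covariance programme)]
-/

namespace Summit.CriticalPhenomena.PercolationContinuityZ3.Theorems

open Finset Literature.Probability.Percolation

namespace Coefficientwise

variable {ι V : Type*} [Fintype ι] [DecidableEq ι] (ends : ι → Sym2 V) (x : V)

open Classical in
/-- **The hybrid-spin exclusion is nonnegative for monotone `g`** — by `hybrid_eq_half_cross` and THEOREM CROSS (`noCore_cross_nonneg`, gen 49).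
[cite: KozmaNitzan2024, Questions 8–9 (§5.5 p. 36) (context)] -/
theorem hybrid_nonneg (p q : V) (g : Set V → ℝ) (hg : Monotone g) :
    0 ≤ ∑ t : Finset ι, (if ¬ (p ∈ openCluster (ends '' (↑t : Set ι)) x ∧ q ∈ openCluster (ends '' (↑(tᶜ) : Set ι)) x) then
        ((if q ∈ openCluster (ends '' (↑t : Set ι)) x then (1 : ℝ) else 0) - (if p ∈ openCluster (ends '' (↑(tᶜ) : Set ι)) x then (1 : ℝ) else 0)) *
          (g (openCluster (ends '' (↑t : Set ι)) x) - g (openCluster (ends '' (↑(tᶜ) : Set ι)) x))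
      else 0) := by
  rw [hybrid_eq_half_cross ends x p q g]
  have := noCore_cross_nonneg ends x p q g hg
  positivity

section degtwo

variable {u p q : V} {i₁ i₂ : ι}

open Classical in
/-- **THEOREM (DIAMOND): the two-point exclusion at a degree-two vertex.**  If `u ∉ {x, p, q}` has exactly the two edges `i₁` (ends `{u,p}`) and `i₂` (ends `{u,q}`), `i₁ ≠ i₂`,
then for every monotone `g` ignoring `u`:  `0 ≤ Q_mix(p,q)[1_u, g] = Σ_{s : ¬(p ∈ K s ∧ q ∈ K sᶜ)} ([u ∈ K s] − [u ∈ K sᶜ])·(g(K s) − g(K sᶜ))` on every finite multigraph.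
Proof: resolve `D = {i₁,i₂}` (`sum_cube_eq_sum_powerset_subcube`); the classes with `i₁` red are `qmixStarClass_nonneg_of_red`, the class with both blue is
`qmixStarClass_nonneg_of_blue_blue` (gen 49), and the class `{i₁ blue, i₂ red}` is the hybrid-spin exclusion of `G − u` (`degTwo_blueRed_class_eq_hybrid`), nonnegative by
THEOREM CROSS (`hybrid_nonneg`).  (`p = q` is allowed.)  [cite: KozmaNitzan2024, Questions 8–9 (§5.5 p. 36) (context)] -/
theorem qmix_nonneg_of_degTwo (hi₁ : ends i₁ = s(u, p)) (hi₂ : ends i₂ = s(u, q)) (hne : i₁ ≠ i₂)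
    (hdeg : ∀ i, u ∈ ends i → i = i₁ ∨ i = i₂) (hpu : p ≠ u) (hqu : q ≠ u) (hxu : x ≠ u)
    (g : Set V → ℝ) (hg : Monotone g) (hgu : ∀ C : Set V, g (insert u C) = g C) :
    0 ≤ ∑ s ∈ univ.filter (fun s : Finset ι => ¬ (p ∈ openCluster (ends '' (↑s : Set ι)) x ∧ q ∈ openCluster (ends '' (↑(sᶜ) : Set ι)) x)),
      ((if u ∈ openCluster (ends '' (↑s : Set ι)) x then (1 : ℝ) else 0) - (if u ∈ openCluster (ends '' (↑(sᶜ) : Set ι)) x then (1 : ℝ) else 0)) *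
        (g (openCluster (ends '' (↑s : Set ι)) x) - g (openCluster (ends '' (↑(sᶜ) : Set ι)) x)) := by
  have hD : ∀ i ∈ ({i₁, i₂} : Finset ι), u ∈ ends i := by
    intro i hi
    rcases Finset.mem_insert.mp hi with rfl | hi
    · rw [hi₁]; exact Sym2.mem_mk_left _ _
    · rw [Finset.mem_singleton.mp hi, hi₂]; exact Sym2.mem_mk_left _ _
  have hi₁D : i₁ ∈ ({i₁, i₂} : Finset ι) := by simp
  have hi₂D : i₂ ∈ ({i₁, i₂} : Finset ι) := by simp
  rw [Finset.sum_filter]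
  rw [sum_cube_eq_sum_powerset_subcube ({i₁, i₂} : Finset ι) (fun s t =>
      if ¬ (p ∈ openCluster (ends '' (↑s : Set ι)) x ∧ q ∈ openCluster (ends '' (↑t : Set ι)) x) then
        ((if u ∈ openCluster (ends '' (↑s : Set ι)) x then (1 : ℝ) else 0) - (if u ∈ openCluster (ends '' (↑t : Set ι)) x then (1 : ℝ) else 0)) *
          (g (openCluster (ends '' (↑s : Set ι)) x) - g (openCluster (ends '' (↑t : Set ι)) x)) else 0)]
  refine Finset.sum_nonneg fun R hR => ?_
  have hRD : R ⊆ ({i₁, i₂} : Finset ι) := Finset.mem_powerset.mp hR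
  by_cases h1 : i₁ ∈ R
  · exact qmixStarClass_nonneg_of_red ends x ({i₁, i₂} : Finset ι) R hRD hD hi₁ hpu h1 q g hg
  · by_cases h2 : i₂ ∈ R
    · have hReq : R = {i₂} := by
        ext a
        constructor
        · intro ha
          rcases Finset.mem_insert.mp (hRD ha) with rfl | ha'
          · exact absurd ha h1
          · exact ha'
        · intro ha; rw [Finset.mem_singleton.mp ha]; exact h2
      subst hReq
      rw [degTwo_blueRed_class_eq_hybrid ends x hi₁ hi₂ hne hdeg hpu hqu hxu g hgu]
      exact hybrid_nonneg (fun j : {j : ι // j ∉ ({i₁, i₂} : Finset ι)} => ends j.1) x p q g hg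
    · exact qmixStarClass_nonneg_of_blue_blue ends x ({i₁, i₂} : Finset ι) R hRD hD hi₁ hpu (Finset.mem_sdiff.mpr ⟨hi₁D, h1⟩)
        hi₂ hqu (Finset.mem_sdiff.mpr ⟨hi₂D, h2⟩) g hg

end degtwo

section twin

variable {y u p q : V} {j₁ j₂ i₁ i₂ : ι}

open Classical in
/-- **COROLLARY (TWIN DIAMOND): NO-CORE for two degree-two vertices on the same pair.**  Let `y ∉ {x,p,q}` have exactly the two edges `j₁ = yp`, `j₂ = yq`, let `u ∉ {x,y,p,q}`
have exactly the two edges `i₁ = up`, `i₂ = uq`, and let the monotone `g` ignore `y` and `u`.  Then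
`0 ≤ NO-CORE(y)[1_u, g] = Σ_{s : ¬(y ∈ K s ∧ y ∈ K sᶜ)} ([u ∈ K s] − [u ∈ K sᶜ])·(g(K s) − g(K sᶜ))` on every finite multigraph (the rest of the graph and the mutual position
of `p, q, x` are arbitrary; `p = q` allowed).  Proof: gen 48's degree-two reduction `noCore_degTwo_nonneg_of_qmix` with the two `G − y` exclusions `Q_mix(p,q)[1_u]`, `Q_mix(q,p)[1_u]`
supplied by the DIAMOND `qmix_nonneg_of_degTwo` on the multigraph `G − y` (edge type `{j // j ≠ j₁ ∧ j ≠ j₂}`), where `u` still has exactly the edges `i₁, i₂`.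
[cite: KozmaNitzan2024, Questions 8–9 (§5.5 p. 36) (context)] -/
theorem noCore_twinDiamond_nonneg (hj₁ : ends j₁ = s(y, p)) (hj₂ : ends j₂ = s(y, q)) (hjne : j₁ ≠ j₂)
    (hdegy : ∀ i, y ∈ ends i → i = j₁ ∨ i = j₂)
    (hi₁ : ends i₁ = s(u, p)) (hi₂ : ends i₂ = s(u, q)) (hine : i₁ ≠ i₂)
    (hdegu : ∀ i, u ∈ ends i → i = i₁ ∨ i = i₂)
    (hpy : p ≠ y) (hqy : q ≠ y) (hxy : x ≠ y) (hpu : p ≠ u) (hqu : q ≠ u) (hxu : x ≠ u) (hyu : y ≠ u)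
    (g : Set V → ℝ) (hg : Monotone g) (hgy : ∀ C : Set V, g (insert y C) = g C) (hgu : ∀ C : Set V, g (insert u C) = g C) :
    0 ≤ ∑ s ∈ univ.filter (fun s : Finset ι =>
        ¬ (y ∈ openCluster (ends '' (↑s : Set ι)) x ∧ y ∈ openCluster (ends '' (↑(sᶜ) : Set ι)) x)),
      ((if u ∈ openCluster (ends '' (↑s : Set ι)) x then (1 : ℝ) else 0) - (if u ∈ openCluster (ends '' (↑(sᶜ) : Set ι)) x then (1 : ℝ) else 0)) *
        (g (openCluster (ends '' (↑s : Set ι)) x) - g (openCluster (ends '' (↑(sᶜ) : Set ι)) x)) := by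
  -- the edges of `u` avoid `y`, so they survive in `G − y`
  have hi₁ne : i₁ ≠ j₁ ∧ i₁ ≠ j₂ := by
    constructor
    · rintro rfl
      have : y ∈ ends i₁ := by rw [hj₁]; exact Sym2.mem_mk_left _ _
      rw [hi₁, Sym2.mem_iff] at this
      rcases this with h | h
      · exact hyu h
      · exact hpy h.symm
    · rintro rfl
      have : y ∈ ends i₁ := by rw [hj₂]; exact Sym2.mem_mk_left _ _
      rw [hi₁, Sym2.mem_iff] at this
      rcases this with h | h
      · exact hyu h
      · exact hpy h.symm
  have hi₂ne : i₂ ≠ j₁ ∧ i₂ ≠ j₂ := by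
    constructor
    · rintro rfl
      have : y ∈ ends i₂ := by rw [hj₁]; exact Sym2.mem_mk_left _ _
      rw [hi₂, Sym2.mem_iff] at this
      rcases this with h | h
      · exact hyu h
      · exact hqy h.symm
    · rintro rfl
      have : y ∈ ends i₂ := by rw [hj₂]; exact Sym2.mem_mk_left _ _
      rw [hi₂, Sym2.mem_iff] at this
      rcases this with h | h
      · exact hyu h
      · exact hqy h.symm
  set ends' : {j : ι // j ≠ j₁ ∧ j ≠ j₂} → Sym2 V := fun j => ends j.1 with hends'
  have hi₁' : ends' ⟨i₁, hi₁ne⟩ = s(u, p) := hi₁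
  have hi₂' : ends' ⟨i₂, hi₂ne⟩ = s(u, q) := hi₂
  have hine' : (⟨i₁, hi₁ne⟩ : {j : ι // j ≠ j₁ ∧ j ≠ j₂}) ≠ ⟨i₂, hi₂ne⟩ := fun h => hine (congrArg Subtype.val h)
  have hdegu' : ∀ i : {j : ι // j ≠ j₁ ∧ j ≠ j₂}, u ∈ ends' i → i = ⟨i₁, hi₁ne⟩ ∨ i = ⟨i₂, hi₂ne⟩ := by
    intro i hi
    rcases hdegu i.1 hi with h | h
    · left; exact Subtype.ext h
    · right; exact Subtype.ext h
  have hfm : Monotone (fun C : Set V => if u ∈ C then (1 : ℝ) else 0) := fun A B hAB => by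
    by_cases hA : u ∈ A
    · simp [hA, hAB hA]
    · simp only [hA, if_false]; split_ifs <;> norm_num
  have hfy : ∀ C : Set V, (fun C : Set V => if u ∈ C then (1 : ℝ) else 0) (insert y C) = (fun C : Set V => if u ∈ C then (1 : ℝ) else 0) C :=
    fun C => by simp [Set.mem_insert_iff, hyu.symm]
  have hQpq := qmix_nonneg_of_degTwo ends' x hi₁' hi₂' hine' hdegu' hpu hqu hxu g hg hgu
  have hQqp := qmix_nonneg_of_degTwo ends' x hi₂' hi₁' hine'.symm (fun i hi => (hdegu' i hi).symm) hqu hpu hxu g hg hgu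
  exact noCore_degTwo_nonneg_of_qmix ends x (fun C : Set V => if u ∈ C then (1 : ℝ) else 0) g hj₁ hj₂ hjne hdegy hpy hqy hxy hfm hg hfy hgy
    hQpq hQqp

end twin

end Coefficientwise

end Summit.CriticalPhenomena.PercolationContinuityZ3.Theorems
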